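import Literature.NumberTheory.Rogawski1990.ArchUniversalPinRatioOfWallCompatible   -- ★ p844390 U5 (A-p19): the (cpt) tokens (`endoEmb`, `endoForm_archLocal_diagonal`, `endoEmb_mem_centralizer_circleDiagonal`)
import Literature.NumberTheory.Weil1964.UnitaryArchLocalTraceFormNondegenerate      -- ★ p844433 U1′: `isHaarMeasure_archLocalTopFormHaar_diagonal` (+ ★ U1 FILE C `archLocalTopFormHaar`)
import Literature.NumberTheory.Weil1964.UnitaryArchLocalSkewCongrDiagonal            -- ★ p844697 (this seat) FILE 3: `localTopFormHaar_univ_eq_of_definite_diagonal_of_mass`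
import HarnessLib

/-!
# The (cpt) clause of U4 `ArchTopFormWallCompatible` FROM THE WINDOW-FREE MASS FORMULA: one `V` for all compact walls once `vol^TF(U(Jw)(ℂ)) = ∫_{source(Jw)} w₀ dλ`
# ((U) road, U4-DISCHARGE (cpt) half — the ASSEMBLER; LEAD F0P3a-plan (g10) WORD T9-40 (d2); Rogawski 1990 §1.7 p. 6, §8.2 p. 119)

Topic `NumberTheory/Rogawski1990`; namespace `Literature.NumberTheory.Rogawski1990`.  THEOREMS ONLY (no `def`, no instance, no notation, no axiom, no named fact, no `sorry`).
Cell `pub/hodgecm-mathlib`, crux H413 = `stmt-HodgeConjecture-24833` (supports only).  Count-neutral.  HONEST LABEL: HC_CM is proved only modulo the printed citations until rung 0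
closes; U4 (★ p844462 `ArchTopFormWallCompatible L`, route-side, the hypothesis `hW` of the closer ED. 29 «U PAID») is an IN-HOUSE normalisation statement and this file pays
its COMPACT-WALL conjunct down to ONE analytic input — the window-free mass formula (ii) «`localTopFormHaar N Jw (univ) = ∫⁻_{cayleySourceC} w₀ dλ`» for hermitian invertible
`Jw` of sizes `N = 2, 1` (A-p06 (g29), T9-40; the VALUE of `V`, e.g. ★-to-be `lintegral_cayleyWeightC_one = π` (A-p12 (g20)), is then read off the reference carriers `1₂, 1₁`).

HEAD **`archTopFormWallCompatible_cpt_of_mass`**: conclusion = the (cpt) conjunct of ★ p844462 VERBATIM (`∀ w β …, 0 < re σβ₀·re σβ₂ → (map ι_w (μ^TF_2 ⊗ μ^TF_1)) univ = V`), for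
ANY `V : ℝ≥0` with `(∫_{source(1₂)} w₀ dλ) · (∫_{source(1₁)} w₀ dλ) = V`, GIVEN (ii) at `N = 2` and `N = 1`.  PROOF: the wall-block map is (the inverse of) a homeomorphism (★ (V9)
`exists_centralizer_continuousMulEquiv_of_splitSingular`), so the mass is `μ^TF_2(univ) · μ^TF_1(univ)` (`Measure.prod_prod`); `μ^TF_N = localTopFormHaar N ((diagonal b).map σ_w)`
(★ U1 FILE C, definitional) and `(diagonal b).map σ_w = diagonal (re σ_w b)` is a DEFINITE real diagonal carrier at a compact wall; ★ FILE 3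
`localTopFormHaar_univ_eq_of_definite_diagonal_of_mass` (congruence transport on the Lie algebra, ★ FILE 1) moves every such carrier to the reference `1_N`.

## References
* [Rogawski1990] J. D. Rogawski, *Automorphic Representations of Unitary Groups in Three Variables*, Ann. of Math. Stud. 123 (1990), §1.7 p. 6; §8.2 p. 119.
* [Macdonald1980] I. G. Macdonald, *The volume of a compact Lie group*, Invent. Math. 56 (1980), p. 93.
* [Folland1995] G. B. Folland, *A Course in Abstract Harmonic Analysis* (1995), §2.6 (2.52).
-/

set_option autoImplicit false
set_option backward.isDefEq.respectTransparency false

noncomputable section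

open MeasureTheory Measure Set Filter Topology NumberField NumberField.InfinitePlace NumberField.mixedEmbedding Matrix Equiv
open Literature.MeasureTheory.Group Literature.NumberTheory.Automorphic Literature.NumberTheory.Automorphic.UnitaryGroup
open Literature.NumberTheory.Weil1964 Literature.NumberTheory.Weil1964.UnitaryArchTopForm Literature.NumberTheory.Weil1964.UnitaryArchLocalTopForm
open scoped ENNReal NNReal Classical Matrix MatrixGroups Matrix.Norms.Operator ContDiff ComplexConjugate

namespace Literature.NumberTheory.Rogawski1990

/-! ## §1 Small tools: real diagonal carriers at a place, masses along an equality of carriers -/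

section Tools

variable (L : Type) [Field L] [NumberField L] [IsCMField L]

/-- At a complex place a `c`-fixed diagonal carrier reads as a REAL diagonal complex matrix: `(diagonal b).map σ_w = diagonal (re σ_w b_i)`. [cite: Rogawski1990, §1.7 p. 6] -/
theorem diagonal_map_embedding_eq_diagonal_re {n : ℕ} (w : {w : InfinitePlace L // IsComplex w}) (b : Fin n → L)
    (hbr : ∀ i, (IsCMField.complexConj L (b i) : L) = b i) :
    (Matrix.diagonal b).map w.1.embedding = Matrix.diagonal fun i => (((w.1.embedding (b i)).re : ℝ) : ℂ) := by
  rw [Matrix.diagonal_map (map_zero _)]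
  congr 1
  funext i
  exact Complex.ext (by simp) (by simpa using UnitaryGroup.im_embedding_eq_zero_of_complexConj_eq L w (hbr i))

omit [NumberField L] [IsCMField L] in
/-- Masses along an equality of carriers: `vol^TF(U(J)) = vol^TF(U(J′))` for `J = J′` (the measures live on different types; the numbers agree). [folklore] -/
private theorem localTopFormHaar_univ_congr {n : ℕ} [MeasurableSpace (GL (Fin n) ℂ)] [BorelSpace (GL (Fin n) ℂ)] {J J' : Matrix (Fin n) (Fin n) ℂ} (h : J = J') :
    localTopFormHaar n J Set.univ = localTopFormHaar n J' Set.univ := by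
  subst h; rfl

/-- A real diagonal complex matrix is hermitian. [folklore] -/
private theorem conjTranspose_diagonal_ofReal {n : ℕ} (d : Fin n → ℝ) : (Matrix.diagonal fun i => ((d i : ℝ) : ℂ))ᴴ = Matrix.diagonal fun i => ((d i : ℝ) : ℂ) := by
  rw [Matrix.diagonal_conjTranspose]
  congr 1; funext i; exact Complex.conj_ofReal _

/-- A real diagonal complex matrix with non-zero entries is invertible. [folklore] -/
private theorem isUnit_det_diagonal_ofReal {n : ℕ} (d : Fin n → ℝ) (hd : ∀ i, d i ≠ 0) : IsUnit (Matrix.diagonal fun i => ((d i : ℝ) : ℂ)).det := by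
  rw [Matrix.det_diagonal, isUnit_iff_ne_zero, Finset.prod_ne_zero_iff]
  exact fun i _ => Complex.ofReal_ne_zero.2 (hd i)

end Tools

/-! ## §2 The (cpt) clause of U4 from the window-free mass formula -/

variable (L : Type) [Field L] [NumberField L] [IsCMField L]

/-- **U4 (cpt) FROM THE MASS FORMULA.**  Suppose (ii): for every hermitian invertible `Jw` of size `2` (resp. `1`) the total mass of ★ `localTopFormHaar` is the source integral of
the Cayley weight against the trace-form Lebesgue measure.  Then for every `V : ℝ≥0` with `(∫_{source(1₂)} w₀ dλ)·(∫_{source(1₁)} w₀ dλ) = V`, the COMPACT-WALL conjunct of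
★ `ArchTopFormWallCompatible L` holds with this `V` (text verbatim): at every complex place `w`, every real non-degenerate diagonal carrier `β` with `re σβ₀ · re σβ₂ > 0` and every
reference wall point, the wall-block measure `(μ^TF_2(diag(β₀,β₂)) ⊗ μ^TF_1((β₁)))_* ι_w` has total mass `V`.  (The blocks are DEFINITE real diagonal at such a wall; ★ FILE 3 moves
them to `1₂`, `1₁`.) [cite: Rogawski1990, §1.7 p. 6; §8.2 p. 119] [cite: Macdonald1980, p. 93] [cite: Folland1995, §2.6 (2.52)] -/
theorem archTopFormWallCompatible_cpt_of_mass
    (hmass2 : ∀ (Jw : Matrix (Fin 2) (Fin 2) ℂ) [MeasurableSpace (GL (Fin 2) ℂ)] [BorelSpace (GL (Fin 2) ℂ)] [MeasurableSpace (skewC 2 Jw)] [BorelSpace (skewC 2 Jw)],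
      Jwᴴ = Jw → IsUnit Jw.det → localTopFormHaar 2 Jw Set.univ = ∫⁻ X in cayleySourceC 2 Jw, ENNReal.ofReal (cayleyWeightC 2 Jw X) ∂(lieStdLebesgueC 2 Jw))
    (hmass1 : ∀ (Jw : Matrix (Fin 1) (Fin 1) ℂ) [MeasurableSpace (GL (Fin 1) ℂ)] [BorelSpace (GL (Fin 1) ℂ)] [MeasurableSpace (skewC 1 Jw)] [BorelSpace (skewC 1 Jw)],
      Jwᴴ = Jw → IsUnit Jw.det → localTopFormHaar 1 Jw Set.univ = ∫⁻ X in cayleySourceC 1 Jw, ENNReal.ofReal (cayleyWeightC 1 Jw X) ∂(lieStdLebesgueC 1 Jw))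
    [i2 : MeasurableSpace (skewC 2 (Matrix.diagonal fun _ : Fin 2 => ((1 : ℝ) : ℂ)))] [BorelSpace (skewC 2 (Matrix.diagonal fun _ : Fin 2 => ((1 : ℝ) : ℂ)))]
    [i1 : MeasurableSpace (skewC 1 (Matrix.diagonal fun _ : Fin 1 => ((1 : ℝ) : ℂ)))] [BorelSpace (skewC 1 (Matrix.diagonal fun _ : Fin 1 => ((1 : ℝ) : ℂ)))]
    {V : ℝ≥0}
    (hV : (∫⁻ X in cayleySourceC 2 (Matrix.diagonal fun _ : Fin 2 => ((1 : ℝ) : ℂ)), ENNReal.ofReal (cayleyWeightC 2 _ X) ∂(lieStdLebesgueC 2 _)) *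
      (∫⁻ X in cayleySourceC 1 (Matrix.diagonal fun _ : Fin 1 => ((1 : ℝ) : ℂ)), ENNReal.ofReal (cayleyWeightC 1 _ X) ∂(lieStdLebesgueC 1 _)) = V) :
    ∀ [MeasurableSpace (GL (Fin 2) ℂ)] [BorelSpace (GL (Fin 2) ℂ)] [MeasurableSpace (GL (Fin 1) ℂ)] [BorelSpace (GL (Fin 1) ℂ)]
      [MeasurableSpace (GL (Fin 3) ℂ)] [BorelSpace (GL (Fin 3) ℂ)]
      (w : {w : InfinitePlace L // IsComplex w}) (β : Fin 3 → L) (_hβ : ∀ i, β i ≠ 0) (_hhermβ : ∀ i, (IsCMField.complexConj L (β i) : L) = β i)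
      (z₁ : Fin 3 → Circle) (h02 : z₁ 0 = z₁ 2) (_h01 : z₁ 0 ≠ z₁ 1),
      0 < (w.1.embedding (β 0)).re * (w.1.embedding (β 2)).re →
      (Measure.map (fun p : ↥(archLocal L 2 (Matrix.diagonal ![β 0, β 2]) w) × ↥(archLocal L 1 (Matrix.diagonal ![β 1]) w) =>
            (⟨endoEmb (starRingEnd ℂ) ((Matrix.diagonal ![β 0, β 2]).map w.1.embedding) ((Matrix.diagonal ![β 1]).map w.1.embedding)
                ((Matrix.diagonal β).map w.1.embedding) (endoForm_archLocal_diagonal L β w) p,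
              endoEmb_mem_centralizer_circleDiagonal L β w h02 p⟩ : ↥(Subgroup.centralizer ({(⟨circleDiagonal 3 z₁, circleDiagonal_mem_archLocal_diagonal L 3 β w z₁⟩ : archLocal L 3 (Matrix.diagonal β) w)} : Set (archLocal L 3 (Matrix.diagonal β) w)))))
          ((archLocalTopFormHaar L 2 (Matrix.diagonal ![β 0, β 2]) w).prod (archLocalTopFormHaar L 1 (Matrix.diagonal ![β 1]) w))) Set.univ = V := by
  intro _ _ _ _ _ _ w β hβ hhermβ z₁ h02 h01 hs
  have hreal : ∀ i, (w.1.embedding (β i)).im = 0 := fun i => UnitaryGroup.im_embedding_eq_zero_of_complexConj_eq L w (hhermβ i)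
  haveI := locallyCompactSpace_archLocal L 2 (Matrix.diagonal ![β 0, β 2]) w
  haveI := secondCountableTopology_archLocal L 2 (Matrix.diagonal ![β 0, β 2]) w
  haveI := locallyCompactSpace_archLocal L 1 (Matrix.diagonal ![β 1]) w
  haveI := secondCountableTopology_archLocal L 1 (Matrix.diagonal ![β 1]) w
  haveI : (archLocalTopFormHaar L 2 (Matrix.diagonal ![β 0, β 2]) w).IsHaarMeasure :=
    isHaarMeasure_archLocalTopFormHaar_diagonal L 2 w ![β 0, β 2] (fun i => by fin_cases i <;> simp [hβ]) (fun i => by fin_cases i <;> simp [hhermβ])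
  haveI : (archLocalTopFormHaar L 1 (Matrix.diagonal ![β 1]) w).IsHaarMeasure :=
    isHaarMeasure_archLocalTopFormHaar_diagonal L 1 w ![β 1] (fun i => by fin_cases i; simp [hβ]) (fun i => by fin_cases i; simp [hhermβ])
  -- the same facts in the `unitaryGroupOfForm`-spelling of ★ (V9)'s equivalence (`archLocal` is a plain `def`)
  haveI : SecondCountableTopology ↥(unitaryGroupOfForm (starRingEnd ℂ) ((Matrix.diagonal ![β 0, β 2]).map w.1.embedding)) :=
    secondCountableTopology_archLocal L 2 (Matrix.diagonal ![β 0, β 2]) w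
  haveI : SecondCountableTopology ↥(unitaryGroupOfForm (starRingEnd ℂ) ((Matrix.diagonal ![β 1]).map w.1.embedding)) :=
    secondCountableTopology_archLocal L 1 (Matrix.diagonal ![β 1]) w
  haveI : BorelSpace (↥(unitaryGroupOfForm (starRingEnd ℂ) ((Matrix.diagonal ![β 0, β 2]).map w.1.embedding)) ×
      ↥(unitaryGroupOfForm (starRingEnd ℂ) ((Matrix.diagonal ![β 1]).map w.1.embedding))) := Prod.borelSpace
  haveI : BorelSpace (↥(archLocal L 2 (Matrix.diagonal ![β 0, β 2]) w) × ↥(archLocal L 1 (Matrix.diagonal ![β 1]) w)) := Prod.borelSpace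
  -- the wall-block map is the inverse of ★ (V9)'s homeomorphism: total mass = product of the block masses
  obtain ⟨e, he⟩ := exists_centralizer_continuousMulEquiv_of_splitSingular L β w h02 h01
  have hfun : (fun p : ↥(archLocal L 2 (Matrix.diagonal ![β 0, β 2]) w) × ↥(archLocal L 1 (Matrix.diagonal ![β 1]) w) =>
      (⟨endoEmb (starRingEnd ℂ) ((Matrix.diagonal ![β 0, β 2]).map w.1.embedding) ((Matrix.diagonal ![β 1]).map w.1.embedding)
          ((Matrix.diagonal β).map w.1.embedding) (endoForm_archLocal_diagonal L β w) p,
        endoEmb_mem_centralizer_circleDiagonal L β w h02 p⟩ : ↥(Subgroup.centralizer ({(⟨circleDiagonal 3 z₁, circleDiagonal_mem_archLocal_diagonal L 3 β w z₁⟩ : archLocal L 3 (Matrix.diagonal β) w)} : Set (archLocal L 3 (Matrix.diagonal β) w))))) = ⇑e.symm :=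
    funext fun p => Subtype.ext (he p).symm
  have hme : Measurable (⇑e.symm : ↥(archLocal L 2 (Matrix.diagonal ![β 0, β 2]) w) × ↥(archLocal L 1 (Matrix.diagonal ![β 1]) w) →
      ↥(Subgroup.centralizer ({(⟨circleDiagonal 3 z₁, circleDiagonal_mem_archLocal_diagonal L 3 β w z₁⟩ : archLocal L 3 (Matrix.diagonal β) w)} : Set (archLocal L 3 (Matrix.diagonal β) w)))) :=
    e.symm.continuous.measurable
  rw [hfun]
  refine (Measure.map_apply hme MeasurableSet.univ).trans ?_
  rw [Set.preimage_univ, ← Set.univ_prod_univ]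
  refine (Measure.prod_prod (μ := archLocalTopFormHaar L 2 (Matrix.diagonal ![β 0, β 2]) w) (ν := archLocalTopFormHaar L 1 (Matrix.diagonal ![β 1]) w)
    (Set.univ : Set (archLocal L 2 (Matrix.diagonal ![β 0, β 2]) w)) (Set.univ : Set (archLocal L 1 (Matrix.diagonal ![β 1]) w))).trans ?_
  -- the two block masses, read on the definite real diagonal carriers and moved to the references `1₂`, `1₁`
  set d2 : Fin 2 → ℝ := fun i => (w.1.embedding (![β 0, β 2] i)).re with hd2
  set d1 : Fin 1 → ℝ := fun i => (w.1.embedding (![β 1] i)).re with hd1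
  have hJ2 : (Matrix.diagonal ![β 0, β 2]).map w.1.embedding = Matrix.diagonal fun i => ((d2 i : ℝ) : ℂ) :=
    diagonal_map_embedding_eq_diagonal_re L w ![β 0, β 2] (fun i => by fin_cases i <;> simp [hhermβ])
  have hJ1 : (Matrix.diagonal ![β 1]).map w.1.embedding = Matrix.diagonal fun i => ((d1 i : ℝ) : ℂ) :=
    diagonal_map_embedding_eq_diagonal_re L w ![β 1] (fun i => by fin_cases i; simp [hhermβ])
  -- signs: the `2`-block is definite, the `1`-block is non-zero
  have hsd2 : (∀ i, 0 < d2 i) ∨ (∀ i, d2 i < 0) := by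
    rcases mul_pos_iff.1 hs with ⟨h0, h2⟩ | ⟨h0, h2⟩
    · left
      intro i; fin_cases i
      · simpa [hd2] using h0
      · simpa [hd2] using h2
    · right
      intro i; fin_cases i
      · simpa [hd2] using h0
      · simpa [hd2] using h2
  have hre1 : (w.1.embedding (β 1)).re ≠ 0 := by
    intro h0
    apply hβ 1
    have : w.1.embedding (β 1) = 0 := Complex.ext h0 (hreal 1)
    exact (map_eq_zero _).1 this
  have hsd1 : (∀ i, 0 < d1 i) ∨ (∀ i, d1 i < 0) := by
    rcases lt_or_gt_of_ne hre1 with hneg | hpos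
    · right; intro i; fin_cases i; simpa [hd1] using hneg
    · left; intro i; fin_cases i; simpa [hd1] using hpos
  -- Borel structures on the Lie algebras of the four carriers involved
  letI iM2 : MeasurableSpace (skewC 2 (Matrix.diagonal fun i => ((d2 i : ℝ) : ℂ))) := borel _
  haveI iB2 : BorelSpace (skewC 2 (Matrix.diagonal fun i => ((d2 i : ℝ) : ℂ))) := ⟨rfl⟩
  letI iM1 : MeasurableSpace (skewC 1 (Matrix.diagonal fun i => ((d1 i : ℝ) : ℂ))) := borel _
  haveI iB1 : BorelSpace (skewC 1 (Matrix.diagonal fun i => ((d1 i : ℝ) : ℂ))) := ⟨rfl⟩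
  have hm2 := hmass2 (Matrix.diagonal fun i => ((d2 i : ℝ) : ℂ)) (conjTranspose_diagonal_ofReal d2)
    (isUnit_det_diagonal_ofReal d2 fun i => by rcases hsd2 with h | h <;> [exact (h i).ne'; exact (h i).ne])
  have hm2r := hmass2 (Matrix.diagonal fun _ : Fin 2 => ((1 : ℝ) : ℂ)) (conjTranspose_diagonal_ofReal _) (isUnit_det_diagonal_ofReal _ fun _ => one_ne_zero)
  have hm1 := hmass1 (Matrix.diagonal fun i => ((d1 i : ℝ) : ℂ)) (conjTranspose_diagonal_ofReal d1)
    (isUnit_det_diagonal_ofReal d1 fun i => by rcases hsd1 with h | h <;> [exact (h i).ne'; exact (h i).ne])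
  have hm1r := hmass1 (Matrix.diagonal fun _ : Fin 1 => ((1 : ℝ) : ℂ)) (conjTranspose_diagonal_ofReal _) (isUnit_det_diagonal_ofReal _ fun _ => one_ne_zero)
  have e2 : archLocalTopFormHaar L 2 (Matrix.diagonal ![β 0, β 2]) w Set.univ =
      ∫⁻ X in cayleySourceC 2 (Matrix.diagonal fun _ : Fin 2 => ((1 : ℝ) : ℂ)), ENNReal.ofReal (cayleyWeightC 2 _ X) ∂(lieStdLebesgueC 2 _) := by
    rw [← hm2r, ← localTopFormHaar_univ_eq_of_definite_diagonal_of_mass d2 (fun _ => (1 : ℝ)) hsd2 (Or.inl fun _ => one_pos) hm2 hm2r]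
    exact localTopFormHaar_univ_congr hJ2
  have e1 : archLocalTopFormHaar L 1 (Matrix.diagonal ![β 1]) w Set.univ =
      ∫⁻ X in cayleySourceC 1 (Matrix.diagonal fun _ : Fin 1 => ((1 : ℝ) : ℂ)), ENNReal.ofReal (cayleyWeightC 1 _ X) ∂(lieStdLebesgueC 1 _) := by
    rw [← hm1r, ← localTopFormHaar_univ_eq_of_definite_diagonal_of_mass d1 (fun _ => (1 : ℝ)) hsd1 (Or.inl fun _ => one_pos) hm1 hm1r]
    exact localTopFormHaar_univ_congr hJ1
  rw [e2, e1, hV]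

end Literature.NumberTheory.Rogawski1990

end
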